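import Summits.QuantumFields.BalabanUV.Beta.GAN24.ExponentialChartBaseCovariantTaylorEnd
import Summits.QuantumFields.BalabanUV.Beta.GAN24.ExponentialChartBaseHessianForm

/-!
# `BalabanUV.Beta.GAN24.ExponentialChartBaseHessianKernels` — binder row G-an2-4 ∕ (CONV-C), route R7 «TWO CURRENCIES», PART 271: THE INFINITE-VOLUME LIMIT KERNELS OF THE ONE-LOOP
# HESSIAN AT A NONZERO SMALL ABELIAN BACKGROUND ARE SYMMETRIC AND BILINEAR IN THE BACKGROUND FAMILIES (PART 258 at the base point `U₀ = e^{iηA₀}`).  PART 269 gives, for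
# volume-indexed real Lipschitz `A_t, B_t` and a base connection on the three-condition disc, kernels `Π_k(A, B)` on `ℤ^d` with `IsInfiniteVolumeLimit` of the family
# `H_{U₀,t}(A_t, B_t) = ∂_r|₀∂_s|₀[(L^{dk}Q_k(Δ_a + (Δ^{exp(iη(A₀,t + sA_t + rB_t))} − Δ^1))⁻¹Q_kᴴ)⁻¹]`; PART 270 gives the finite-volume identities `H_{U₀}(A, B) = H_{U₀}(B, A)`,
# `H_{U₀}(A₁ + A₂, B) = H_{U₀}(A₁, B) + H_{U₀}(A₂, B)`, `H_{U₀}(cA, B) = c·H_{U₀}(A, B)` and the same in `B`, under the invertibility of `Δ_a + (Δ^{U₀} − Δ^1)` and `c_k(U₀)`.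
# Limits in `ℝ` are unique, so ANY infinite-volume limit kernels of these families satisfy **`Π(A, B) = Π(B, A)`**, **`Π(A₁ + A₂, B) = Π(A₁, B) + Π(A₂, B)`**, **`Π(cA, B) = c·Π(A, B)`**
# and the same in `B` — pointwise on `ℤ^d`, every level `k`: the vacuum-polarisation tensor's kernel AT THE BACKGROUND `U₀` is a symmetric bilinear function of the direction
# families.  §0 discharges the two invertibility hypotheses of PARTs 268 ∕ 270 ON THE DISC, BY NAME, for every volume and every transporter `U₀`: `Δ_a^{(k)} + (Δ^{U₀} − Δ^1)^{(k)}` is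
# invertible from NE2's Neumann bound (`T·κ₀ ≤ ½` at `T = 1`) and `c_k(U₀)` from PART 249's ratio `‖1 − Cst⁻¹·c_k(U₀)‖ ≤ 1 − γ_B∕(2Cst) < 1` (`hT₁`, `hT₃`) — PART 269 §1's two
# inline steps made citable (unit b2b-balaban-gan24-p3, gen 67; v1; generator `HOME/b2b-balaban-gan24-p3/gen67/records/gen/gen271.py`)

NOT IN PRINT; OUR PROOF ([folklore] bookkeeping BY NAME over PART 270 (`hessianAt_symm ∕ _add_left ∕ _smul_left ∕ _add_right ∕ _smul_right`), NE2 (`isUnit_det_add_smul_right`,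
`isUnit_det_calDalev`, `covPert_eq`), PART 236 (`perturbationLaws_couplingLetter`), PART 249 (`opNorm_one_sub_smul_pertCov_le_coupling`), PART 268 (`isUnit_det_of_norm_one_sub_smul_lt`),
Mathlib's `tendsto_nhds_unique`, `Filter.Tendsto.congr ∕ add ∕ const_mul`, `Matrix.add_apply ∕ smul_apply`, `Complex.add_re ∕ re_ofReal_mul`; [Balaban1985BackgroundPropagators] (3.3)
p. 390 and [Balaban1987RG1] (1.20)–(1.22) p. 264 LOCATE the shapes; nothing printed is a hypothesis).
HONEST FRAMING (cell contract, verbatim): «discharging `BetaPertH` makes Bałaban's UV stability UNCONDITIONAL — a real constructive-QFT result; it is NOT the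
continuum limit and NOT the Clay problem.»  HONEST DEPENDENCY (verbatim): «continuum YM on T⁴ ⇐ BetaPertH ∧ nine spine estimates (0/9 proved); BetaPertH ⇐
(D1) ∧ (D4) ∧ CAP+tail; G-an2-4 gates asym, D1 and NE2/3/4.»

WHAT THIS FILE PROVES (0 sorry, 0 `def`):
* §0 (every volume `M`, every transporter `U₀`, `1 ≤ d`): **`isUnit_det_calDalev_add_covPert_of_disc`** (`hT₁`), **`isUnit_det_avgTow_pertInv_of_disc`** (`hT₁`, `hT₃`) — the `h0 ∕ hc0`
  of PARTs 268 ∕ 270 from the base connection's Lipschitz ∕ bounded constants.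
* §1 (even cubic volumes `2(t+1)`, level `k`, REAL `A₀, A, B`, `Π` any `IsInfiniteVolumeLimit` kernels of the displayed families, `h0 ∕ hc0` displayed for every volume — §0 on the disc):
  **`hessianAtKernel_symm`**, **`hessianAtKernel_add_left`**, **`hessianAtKernel_smul_left`**, `hessianAtKernel_add_right`, `hessianAtKernel_smul_right`.
WHAT IT DOES NOT DO: existence of the kernels (PART 269 under the Lipschitz + EL₁ + disc hypotheses); the diagonal (needs the one-parameter tower at `U₀`); the secondMoment ∕
`limKernelOf` consequences (PART 259's generic §1 applies verbatim — next file).  SUPPLIER work; NEVER «G-an2-4 closed»; NOT (CONV-C), NOT D1, NOT `BetaPertH`, NOT continuum, NOT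
Clay.  Records: `HOME/b2b-balaban-gan24-p3/gen67/README.md`.
-/

noncomputable section

open scoped BigOperators ComplexConjugate Matrix Matrix.Norms.L2Operator
open Filter Topology

namespace Summit.QuantumFields.BalabanUV.Beta.GAN24.ExponentialChartBaseHessianKernels

open Literature.MathematicalPhysics.QuantumFieldTheory.Balaban1983to89
open Literature.MathematicalPhysics.QuantumFieldTheory.Balaban1983to89.B5Prop11Plancherel (Tor fine Cst Cst_nonneg opNorm_reindex)
open Literature.MathematicalPhysics.QuantumFieldTheory.Balaban1983to89.B5G183RateUnitTower (lev)
open Literature.MathematicalPhysics.QuantumFieldTheory.Balaban1983to89.Beta (Site IsInfiniteVolumeLimit)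
open Literature.MathematicalPhysics.QuantumFieldTheory.Balaban1983to89.Beta.FreeLegDictionary (cubic)
open Literature.MathematicalPhysics.QuantumFieldTheory.Balaban1983to89.Beta.BlockKernelVolumeSockets (evenPeriod)
open Summit.QuantumFields.BalabanUV.T4Continuum
open Summit.QuantumFields.BalabanUV.T4Continuum.CovariantAveragingTower (avgTow)
open Summit.QuantumFields.BalabanUV.T4Continuum.BalabanAveragedTowerUnit (idx QBlev)
open Summit.QuantumFields.BalabanUV.T4Continuum.BalabanAveragedCoerciveTower (unitIdx)
open Summit.QuantumFields.BalabanUV.T4Continuum.BalabanAveragedCoercive (gammaB gammaB_pos)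
open Summit.QuantumFields.BalabanUV.T4Continuum.KingPairingPlantedLaw (calDalev isUnit_det_calDalev)
open Summit.QuantumFields.BalabanUV.T4Continuum.FirstOrderBackgroundModel (LipschitzBackground Pmodel)
open Summit.QuantumFields.BalabanUV.T4Continuum.PerturbationAlgebra (BoundedBackground)
open Summit.QuantumFields.BalabanUV.T4Continuum.AbelianCovariantLaplacian (covPert covPert_eq connV zT)
open Summit.QuantumFields.BalabanUV.T4Continuum.BackgroundResolventLaw (isUnit_det_add_smul_right)
open Summit.QuantumFields.BalabanUV.Beta.GAN24.VolumeLimitCovariance (one_sub_smul_reindex)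
open Summit.QuantumFields.BalabanUV.Beta.GAN24.CouplingLetterStencil (perturbationLaws_couplingLetter)
open Summit.QuantumFields.BalabanUV.Beta.GAN24.CouplingPerturbedVolumeLimit (opNorm_one_sub_smul_pertCov_le_coupling)
open Summit.QuantumFields.BalabanUV.Beta.GAN24.ExponentialChartBaseCovariantTaylor (isUnit_det_of_norm_one_sub_smul_lt)
open Summit.QuantumFields.BalabanUV.Beta.GAN24.ExponentialChartBaseHessianForm (hessianAt_symm hessianAt_add_left hessianAt_smul_left hessianAt_add_right hessianAt_smul_right)

variable {d : ℕ} (L : ℕ) [NeZero L]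

/-! ## §0 The two invertibility hypotheses of PARTs 268 ∕ 270, discharged on the disc (every volume, every transporter) -/

section Disc

variable (M : Fin d → ℕ) [hM : ∀ μ, NeZero (M μ)] (a : ℝ) (ha : 0 < a)

/-- **`isUnit_det_calDalev_add_covPert_of_disc`** — `Δ_a^{(k)} + (Δ^{U₀} − Δ^1)^{(k)}` is invertible whenever the base connection `connV U₀` is Lipschitz `(α₀, β₀)`, `zT U₀` is bounded
`(α₀′, β₀′)` and `κ₀ = 2(d(α₀ + β₀)Cst) + α₀′Cst ≤ ½` (NE2's Neumann bound `isUnit_det_add_smul_right` at coupling `1` on PART 236's `perturbationLaws_couplingLetter`; PART 269 §1's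
first inline step). [our proof] -/
theorem isUnit_det_calDalev_add_covPert_of_disc (hd : 1 ≤ d) {α₀ β₀ α₀' β₀' : ℝ} {U₀ : (k : ℕ) → Fin d → (idx L M k → ℂ)}
    (hw : LipschitzBackground L M (connV L M U₀) α₀ β₀) (hz : BoundedBackground L M (zT L M U₀) α₀' β₀')
    (hT₁ : 1 * (2 * (d * (α₀ + β₀) * Cst d a) + α₀' * Cst d a) ≤ 1 / 2) (k : ℕ) :
    IsUnit (calDalev L M a ha k + covPert L M U₀ k).det := by
  have ht1 : ‖(1 : ℂ)‖ * (2 * (d * (α₀ + β₀) * Cst d a) + α₀' * Cst d a) < 1 := by rw [norm_one]; linarith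
  have h := isUnit_det_add_smul_right (isUnit_det_calDalev L M a ha k) ((perturbationLaws_couplingLetter L M a ha hd hw hw hz).opNorm_P_mul_inv_le k) ht1
  rw [one_smul, ← covPert_eq] at h
  exact h

/-- **`isUnit_det_avgTow_pertInv_of_disc`** — `c_k(U₀) = L^{dk}Q_k(Δ_a + (Δ^{U₀} − Δ^1))⁻¹Q_kᴴ` is invertible on the disc: PART 249's ratio `‖1 − Cst⁻¹·c_k(U₀)‖ ≤ 1 − γ_B∕(2Cst) < 1`
(`hT₁`, `hT₃` at coupling `1`) and PART 268's `isUnit_det_of_norm_one_sub_smul_lt` (PART 269 §1's second inline step). [our proof] -/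
theorem isUnit_det_avgTow_pertInv_of_disc (hd : 1 ≤ d) {α₀ β₀ α₀' β₀' : ℝ} {U₀ : (k : ℕ) → Fin d → (idx L M k → ℂ)}
    (hw : LipschitzBackground L M (connV L M U₀) α₀ β₀) (hz : BoundedBackground L M (zT L M U₀) α₀' β₀')
    (hT₁ : 1 * (2 * (d * (α₀ + β₀) * Cst d a) + α₀' * Cst d a) ≤ 1 / 2) (hT₃ : 4 * 1 * (2 * (d * (α₀ + β₀) * Cst d a) + α₀' * Cst d a) * Cst d a ≤ gammaB d a) (k : ℕ) :
    IsUnit (avgTow (QBlev L M) ((L : ℝ) ^ d) (fun k' => (calDalev L M a ha k' + covPert L M U₀ k')⁻¹) k).det := by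
  have hC : 0 < Cst d a := lt_of_lt_of_le zero_lt_one (le_max_of_le_right (le_max_right _ _))
  have hu : ‖(1 : ℂ)‖ ≤ 1 := by rw [norm_one]
  have h := opNorm_one_sub_smul_pertCov_le_coupling L M a ha hd hw hw hz hT₁ hT₃ hu k
  rw [one_sub_smul_reindex, opNorm_reindex] at h
  simp only [one_smul, ← covPert_eq] at h
  have hlt : 1 - gammaB d a / (2 * Cst d a) < 1 := by
    have := div_pos (gammaB_pos (d := d) a ha) (mul_pos two_pos hC)
    linarith
  exact isUnit_det_of_norm_one_sub_smul_lt (h.trans_lt hlt)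

end Disc

/-! ## §1 The limit kernels at `U₀` are symmetric and bilinear in the direction families (PART 270 volume by volume; uniqueness of limits) -/

section Kernels

variable (a : ℝ) (ha : 0 < a)

/-- **`hessianAtKernel_symm` — THE LIMIT KERNEL OF THE HESSIAN AT `U₀` IS SYMMETRIC IN THE DIRECTIONS**: if `Π` and `Π′` are infinite-volume limit kernels of PART 269's families of
`(A, B)` and `(B, A)` at level `k` (same base `A₀`), then `Π = Π′` pointwise (PART 270's `hessianAt_symm` volume by volume; limits are unique); the invertibility at the base is
displayed for every volume (§0 on the disc). [our proof] -/
theorem hessianAtKernel_symm {A₀ A B : (t : ℕ) → (k : ℕ) → Fin d → (idx L (cubic d (evenPeriod t)) k → ℝ)} (k : ℕ)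
    (h0 : ∀ t, IsUnit (calDalev L (cubic d (evenPeriod t)) a ha k + covPert L (cubic d (evenPeriod t)) (fun k'' ν' (x' : idx L (cubic d (evenPeriod t)) k'') => Complex.exp (Complex.I * ((A₀
          t) k'' ν' x' : ℂ) / ((lev L k'' : ℕ) : ℂ))) k).det)
    (hc0 : ∀ t, IsUnit (avgTow (QBlev L (cubic d (evenPeriod t))) ((L : ℝ) ^ d) (fun k' => (calDalev L (cubic d (evenPeriod t)) a ha k' + covPert L (cubic d (evenPeriod t)) (fun k'' ν' (x'
          : idx L (cubic d (evenPeriod t)) k'') => Complex.exp (Complex.I * ((A₀ t) k'' ν' x' : ℂ) / ((lev L k'' : ℕ) : ℂ))) k')⁻¹) k).det) {P P' : B12Beta.Kernel d}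
    (h : IsInfiniteVolumeLimit evenPeriod
      (fun t μ' ν' (z : Site d (evenPeriod t)) =>
          ((deriv (fun r : ℝ => deriv (fun s : ℝ => (avgTow (QBlev L (cubic d (evenPeriod t))) ((L : ℝ) ^ d)
          (fun k' => (calDalev L (cubic d (evenPeriod t)) a ha k' + covPert L (cubic d (evenPeriod t)) (fun k'' ν' (x' : idx L (cubic d (evenPeriod t)) k'') => Complex.exp
                (Complex.I * ((A₀ t) k'' ν' x' : ℂ) / ((lev L k'' : ℕ) : ℂ) + (Complex.I * ((A t) k'' ν' x' : ℂ) / ((lev L k'' : ℕ) : ℂ)) * ((s : ℝ) : ℂ) + (Complex.I * ((B t) k'' ν' x' :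
                      ℂ) / ((lev L k'' : ℕ) : ℂ)) * ((r : ℝ) :
                ℂ))) k')⁻¹) k)⁻¹) 0) 0)
            ((unitIdx L (cubic d (evenPeriod t))).symm (z, μ')) ((unitIdx L (cubic d (evenPeriod t))).symm (0, ν'))).re) P)
    (h' : IsInfiniteVolumeLimit evenPeriod
      (fun t μ' ν' (z : Site d (evenPeriod t)) =>
          ((deriv (fun r : ℝ => deriv (fun s : ℝ => (avgTow (QBlev L (cubic d (evenPeriod t))) ((L : ℝ) ^ d)
          (fun k' => (calDalev L (cubic d (evenPeriod t)) a ha k' + covPert L (cubic d (evenPeriod t)) (fun k'' ν' (x' : idx L (cubic d (evenPeriod t)) k'') => Complex.exp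
                (Complex.I * ((A₀ t) k'' ν' x' : ℂ) / ((lev L k'' : ℕ) : ℂ) + (Complex.I * ((B t) k'' ν' x' : ℂ) / ((lev L k'' : ℕ) : ℂ)) * ((s : ℝ) : ℂ) + (Complex.I * ((A t) k'' ν' x' :
                      ℂ) / ((lev L k'' : ℕ) : ℂ)) * ((r : ℝ) :
                ℂ))) k')⁻¹) k)⁻¹) 0) 0)
            ((unitIdx L (cubic d (evenPeriod t))).symm (z, μ')) ((unitIdx L (cubic d (evenPeriod t))).symm (0, ν'))).re) P') :
    ∀ μ ν (x : Fin d → ℤ), P μ ν x = P' μ ν x := by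
  intro μ ν x
  refine tendsto_nhds_unique (h μ ν x) ((h' μ ν x).congr fun t => ?_)
  dsimp only
  rw [hessianAt_symm L (cubic d (evenPeriod t)) a ha (A₀ t) (A t) (B t) k (h0 t) (hc0 t)]

/-- **`hessianAtKernel_add_left` — THE LIMIT KERNEL AT `U₀` IS ADDITIVE IN THE FIRST DIRECTION**: limit kernels `Π₁, Π₂, Π₁₂` of the families of `(A₁, B)`, `(A₂, B)`, `(A₁ + A₂, B)`
at level `k` satisfy `Π₁₂ = Π₁ + Π₂` pointwise (PART 270's `hessianAt_add_left`; `Tendsto.add`; uniqueness). [our proof] -/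
theorem hessianAtKernel_add_left {A₀ A₁ A₂ B : (t : ℕ) → (k : ℕ) → Fin d → (idx L (cubic d (evenPeriod t)) k → ℝ)} (k : ℕ)
    (h0 : ∀ t, IsUnit (calDalev L (cubic d (evenPeriod t)) a ha k + covPert L (cubic d (evenPeriod t)) (fun k'' ν' (x' : idx L (cubic d (evenPeriod t)) k'') => Complex.exp (Complex.I * ((A₀
          t) k'' ν' x' : ℂ) / ((lev L k'' : ℕ) : ℂ))) k).det)
    (hc0 : ∀ t, IsUnit (avgTow (QBlev L (cubic d (evenPeriod t))) ((L : ℝ) ^ d) (fun k' => (calDalev L (cubic d (evenPeriod t)) a ha k' + covPert L (cubic d (evenPeriod t)) (fun k'' ν' (x'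
          : idx L (cubic d (evenPeriod t)) k'') => Complex.exp (Complex.I * ((A₀ t) k'' ν' x' : ℂ) / ((lev L k'' : ℕ) : ℂ))) k')⁻¹) k).det) {P₁ P₂ P₁₂ : B12Beta.Kernel d}
    (h₁ : IsInfiniteVolumeLimit evenPeriod
      (fun t μ' ν' (z : Site d (evenPeriod t)) =>
          ((deriv (fun r : ℝ => deriv (fun s : ℝ => (avgTow (QBlev L (cubic d (evenPeriod t))) ((L : ℝ) ^ d)
          (fun k' => (calDalev L (cubic d (evenPeriod t)) a ha k' + covPert L (cubic d (evenPeriod t)) (fun k'' ν' (x' : idx L (cubic d (evenPeriod t)) k'') => Complex.exp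
                (Complex.I * ((A₀ t) k'' ν' x' : ℂ) / ((lev L k'' : ℕ) : ℂ) + (Complex.I * ((A₁ t) k'' ν' x' : ℂ) / ((lev L k'' : ℕ) : ℂ)) * ((s : ℝ) : ℂ) + (Complex.I * ((B t) k'' ν' x' :
                      ℂ) / ((lev L k'' : ℕ) : ℂ)) * ((r : ℝ) :
                ℂ))) k')⁻¹) k)⁻¹) 0) 0)
            ((unitIdx L (cubic d (evenPeriod t))).symm (z, μ')) ((unitIdx L (cubic d (evenPeriod t))).symm (0, ν'))).re) P₁)
    (h₂ : IsInfiniteVolumeLimit evenPeriod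
      (fun t μ' ν' (z : Site d (evenPeriod t)) =>
          ((deriv (fun r : ℝ => deriv (fun s : ℝ => (avgTow (QBlev L (cubic d (evenPeriod t))) ((L : ℝ) ^ d)
          (fun k' => (calDalev L (cubic d (evenPeriod t)) a ha k' + covPert L (cubic d (evenPeriod t)) (fun k'' ν' (x' : idx L (cubic d (evenPeriod t)) k'') => Complex.exp
                (Complex.I * ((A₀ t) k'' ν' x' : ℂ) / ((lev L k'' : ℕ) : ℂ) + (Complex.I * ((A₂ t) k'' ν' x' : ℂ) / ((lev L k'' : ℕ) : ℂ)) * ((s : ℝ) : ℂ) + (Complex.I * ((B t) k'' ν' x' :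
                      ℂ) / ((lev L k'' : ℕ) : ℂ)) * ((r : ℝ) :
                ℂ))) k')⁻¹) k)⁻¹) 0) 0)
            ((unitIdx L (cubic d (evenPeriod t))).symm (z, μ')) ((unitIdx L (cubic d (evenPeriod t))).symm (0, ν'))).re) P₂)
    (h₁₂ : IsInfiniteVolumeLimit evenPeriod
      (fun t μ' ν' (z : Site d (evenPeriod t)) =>
          ((deriv (fun r : ℝ => deriv (fun s : ℝ => (avgTow (QBlev L (cubic d (evenPeriod t))) ((L : ℝ) ^ d)
          (fun k' => (calDalev L (cubic d (evenPeriod t)) a ha k' + covPert L (cubic d (evenPeriod t)) (fun k'' ν' (x' : idx L (cubic d (evenPeriod t)) k'') => Complex.exp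
                (Complex.I * ((A₀ t) k'' ν' x' : ℂ) / ((lev L k'' : ℕ) : ℂ) + (Complex.I * ((A₁ t k'' ν' x' + A₂ t k'' ν' x' : ℝ) : ℂ) / ((lev L k'' : ℕ) : ℂ)) * ((s : ℝ) : ℂ) + (Complex.I
                      * ((B t) k'' ν' x' : ℂ) / ((lev L k'' : ℕ) : ℂ)) * ((r : ℝ) :
                ℂ))) k')⁻¹) k)⁻¹) 0) 0)
            ((unitIdx L (cubic d (evenPeriod t))).symm (z, μ')) ((unitIdx L (cubic d (evenPeriod t))).symm (0, ν'))).re) P₁₂) :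
    ∀ μ ν (x : Fin d → ℤ), P₁₂ μ ν x = P₁ μ ν x + P₂ μ ν x := by
  intro μ ν x
  refine tendsto_nhds_unique (h₁₂ μ ν x) (((h₁ μ ν x).add (h₂ μ ν x)).congr fun t => ?_)
  dsimp only
  rw [hessianAt_add_left L (cubic d (evenPeriod t)) a ha (A₀ t) (A₁ t) (A₂ t) (B t) k (h0 t) (hc0 t), Matrix.add_apply, Complex.add_re]

/-- **`hessianAtKernel_smul_left` — THE LIMIT KERNEL AT `U₀` IS HOMOGENEOUS IN THE FIRST DIRECTION** (real `c`): `Π(cA, B) = c·Π(A, B)` pointwise (PART 270's `hessianAt_smul_left`).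
[our proof] -/
theorem hessianAtKernel_smul_left (c : ℝ) {A₀ A B : (t : ℕ) → (k : ℕ) → Fin d → (idx L (cubic d (evenPeriod t)) k → ℝ)} (k : ℕ)
    (h0 : ∀ t, IsUnit (calDalev L (cubic d (evenPeriod t)) a ha k + covPert L (cubic d (evenPeriod t)) (fun k'' ν' (x' : idx L (cubic d (evenPeriod t)) k'') => Complex.exp (Complex.I * ((A₀
          t) k'' ν' x' : ℂ) / ((lev L k'' : ℕ) : ℂ))) k).det)
    (hc0 : ∀ t, IsUnit (avgTow (QBlev L (cubic d (evenPeriod t))) ((L : ℝ) ^ d) (fun k' => (calDalev L (cubic d (evenPeriod t)) a ha k' + covPert L (cubic d (evenPeriod t)) (fun k'' ν' (x'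
          : idx L (cubic d (evenPeriod t)) k'') => Complex.exp (Complex.I * ((A₀ t) k'' ν' x' : ℂ) / ((lev L k'' : ℕ) : ℂ))) k')⁻¹) k).det) {P Pc : B12Beta.Kernel d}
    (h : IsInfiniteVolumeLimit evenPeriod
      (fun t μ' ν' (z : Site d (evenPeriod t)) =>
          ((deriv (fun r : ℝ => deriv (fun s : ℝ => (avgTow (QBlev L (cubic d (evenPeriod t))) ((L : ℝ) ^ d)
          (fun k' => (calDalev L (cubic d (evenPeriod t)) a ha k' + covPert L (cubic d (evenPeriod t)) (fun k'' ν' (x' : idx L (cubic d (evenPeriod t)) k'') => Complex.exp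
                (Complex.I * ((A₀ t) k'' ν' x' : ℂ) / ((lev L k'' : ℕ) : ℂ) + (Complex.I * ((A t) k'' ν' x' : ℂ) / ((lev L k'' : ℕ) : ℂ)) * ((s : ℝ) : ℂ) + (Complex.I * ((B t) k'' ν' x' :
                      ℂ) / ((lev L k'' : ℕ) : ℂ)) * ((r : ℝ) :
                ℂ))) k')⁻¹) k)⁻¹) 0) 0)
            ((unitIdx L (cubic d (evenPeriod t))).symm (z, μ')) ((unitIdx L (cubic d (evenPeriod t))).symm (0, ν'))).re) P)
    (hc : IsInfiniteVolumeLimit evenPeriod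
      (fun t μ' ν' (z : Site d (evenPeriod t)) =>
          ((deriv (fun r : ℝ => deriv (fun s : ℝ => (avgTow (QBlev L (cubic d (evenPeriod t))) ((L : ℝ) ^ d)
          (fun k' => (calDalev L (cubic d (evenPeriod t)) a ha k' + covPert L (cubic d (evenPeriod t)) (fun k'' ν' (x' : idx L (cubic d (evenPeriod t)) k'') => Complex.exp
                (Complex.I * ((A₀ t) k'' ν' x' : ℂ) / ((lev L k'' : ℕ) : ℂ) + (Complex.I * ((c * A t k'' ν' x' : ℝ) : ℂ) / ((lev L k'' : ℕ) : ℂ)) * ((s : ℝ) : ℂ) + (Complex.I * ((B t) k''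
                      ν' x' : ℂ) / ((lev L k'' : ℕ) : ℂ)) * ((r : ℝ) :
                ℂ))) k')⁻¹) k)⁻¹) 0) 0)
            ((unitIdx L (cubic d (evenPeriod t))).symm (z, μ')) ((unitIdx L (cubic d (evenPeriod t))).symm (0, ν'))).re) Pc) :
    ∀ μ ν (x : Fin d → ℤ), Pc μ ν x = c * P μ ν x := by
  intro μ ν x
  refine tendsto_nhds_unique (hc μ ν x) (((h μ ν x).const_mul c).congr fun t => ?_)
  dsimp only
  rw [hessianAt_smul_left L (cubic d (evenPeriod t)) a ha c (A₀ t) (A t) (B t) k (h0 t) (hc0 t), Matrix.smul_apply, smul_eq_mul, Complex.re_ofReal_mul]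

/-- `hessianAtKernel_add_right` — additivity of the limit kernel at `U₀` in the second direction (PART 270 v2's `hessianAt_add_right`). [our proof] -/
theorem hessianAtKernel_add_right {A₀ A B₁ B₂ : (t : ℕ) → (k : ℕ) → Fin d → (idx L (cubic d (evenPeriod t)) k → ℝ)} (k : ℕ)
    (h0 : ∀ t, IsUnit (calDalev L (cubic d (evenPeriod t)) a ha k + covPert L (cubic d (evenPeriod t)) (fun k'' ν' (x' : idx L (cubic d (evenPeriod t)) k'') => Complex.exp (Complex.I * ((A₀
          t) k'' ν' x' : ℂ) / ((lev L k'' : ℕ) : ℂ))) k).det)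
    (hc0 : ∀ t, IsUnit (avgTow (QBlev L (cubic d (evenPeriod t))) ((L : ℝ) ^ d) (fun k' => (calDalev L (cubic d (evenPeriod t)) a ha k' + covPert L (cubic d (evenPeriod t)) (fun k'' ν' (x'
          : idx L (cubic d (evenPeriod t)) k'') => Complex.exp (Complex.I * ((A₀ t) k'' ν' x' : ℂ) / ((lev L k'' : ℕ) : ℂ))) k')⁻¹) k).det) {P₁ P₂ P₁₂ : B12Beta.Kernel d}
    (h₁ : IsInfiniteVolumeLimit evenPeriod
      (fun t μ' ν' (z : Site d (evenPeriod t)) =>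
          ((deriv (fun r : ℝ => deriv (fun s : ℝ => (avgTow (QBlev L (cubic d (evenPeriod t))) ((L : ℝ) ^ d)
          (fun k' => (calDalev L (cubic d (evenPeriod t)) a ha k' + covPert L (cubic d (evenPeriod t)) (fun k'' ν' (x' : idx L (cubic d (evenPeriod t)) k'') => Complex.exp
                (Complex.I * ((A₀ t) k'' ν' x' : ℂ) / ((lev L k'' : ℕ) : ℂ) + (Complex.I * ((A t) k'' ν' x' : ℂ) / ((lev L k'' : ℕ) : ℂ)) * ((s : ℝ) : ℂ) + (Complex.I * ((B₁ t) k'' ν' x' :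
                      ℂ) / ((lev L k'' : ℕ) : ℂ)) * ((r : ℝ) :
                ℂ))) k')⁻¹) k)⁻¹) 0) 0)
            ((unitIdx L (cubic d (evenPeriod t))).symm (z, μ')) ((unitIdx L (cubic d (evenPeriod t))).symm (0, ν'))).re) P₁)
    (h₂ : IsInfiniteVolumeLimit evenPeriod
      (fun t μ' ν' (z : Site d (evenPeriod t)) =>
          ((deriv (fun r : ℝ => deriv (fun s : ℝ => (avgTow (QBlev L (cubic d (evenPeriod t))) ((L : ℝ) ^ d)
          (fun k' => (calDalev L (cubic d (evenPeriod t)) a ha k' + covPert L (cubic d (evenPeriod t)) (fun k'' ν' (x' : idx L (cubic d (evenPeriod t)) k'') => Complex.exp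
                (Complex.I * ((A₀ t) k'' ν' x' : ℂ) / ((lev L k'' : ℕ) : ℂ) + (Complex.I * ((A t) k'' ν' x' : ℂ) / ((lev L k'' : ℕ) : ℂ)) * ((s : ℝ) : ℂ) + (Complex.I * ((B₂ t) k'' ν' x' :
                      ℂ) / ((lev L k'' : ℕ) : ℂ)) * ((r : ℝ) :
                ℂ))) k')⁻¹) k)⁻¹) 0) 0)
            ((unitIdx L (cubic d (evenPeriod t))).symm (z, μ')) ((unitIdx L (cubic d (evenPeriod t))).symm (0, ν'))).re) P₂)
    (h₁₂ : IsInfiniteVolumeLimit evenPeriod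
      (fun t μ' ν' (z : Site d (evenPeriod t)) =>
          ((deriv (fun r : ℝ => deriv (fun s : ℝ => (avgTow (QBlev L (cubic d (evenPeriod t))) ((L : ℝ) ^ d)
          (fun k' => (calDalev L (cubic d (evenPeriod t)) a ha k' + covPert L (cubic d (evenPeriod t)) (fun k'' ν' (x' : idx L (cubic d (evenPeriod t)) k'') => Complex.exp
                (Complex.I * ((A₀ t) k'' ν' x' : ℂ) / ((lev L k'' : ℕ) : ℂ) + (Complex.I * ((A t) k'' ν' x' : ℂ) / ((lev L k'' : ℕ) : ℂ)) * ((s : ℝ) : ℂ) + (Complex.I * ((B₁ t k'' ν' x' +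
                      B₂ t k'' ν' x' : ℝ) : ℂ) / ((lev L k'' : ℕ) : ℂ)) * ((r : ℝ) :
                ℂ))) k')⁻¹) k)⁻¹) 0) 0)
            ((unitIdx L (cubic d (evenPeriod t))).symm (z, μ')) ((unitIdx L (cubic d (evenPeriod t))).symm (0, ν'))).re) P₁₂) :
    ∀ μ ν (x : Fin d → ℤ), P₁₂ μ ν x = P₁ μ ν x + P₂ μ ν x := by
  intro μ ν x
  refine tendsto_nhds_unique (h₁₂ μ ν x) (((h₁ μ ν x).add (h₂ μ ν x)).congr fun t => ?_)
  dsimp only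
  rw [hessianAt_add_right L (cubic d (evenPeriod t)) a ha (A₀ t) (A t) (B₁ t) (B₂ t) k (h0 t) (hc0 t), Matrix.add_apply, Complex.add_re]

/-- `hessianAtKernel_smul_right` — homogeneity of the limit kernel at `U₀` in the second direction (PART 270 v2's `hessianAt_smul_right`), real `c`. [our proof] -/
theorem hessianAtKernel_smul_right (c : ℝ) {A₀ A B : (t : ℕ) → (k : ℕ) → Fin d → (idx L (cubic d (evenPeriod t)) k → ℝ)} (k : ℕ)
    (h0 : ∀ t, IsUnit (calDalev L (cubic d (evenPeriod t)) a ha k + covPert L (cubic d (evenPeriod t)) (fun k'' ν' (x' : idx L (cubic d (evenPeriod t)) k'') => Complex.exp (Complex.I * ((A₀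
          t) k'' ν' x' : ℂ) / ((lev L k'' : ℕ) : ℂ))) k).det)
    (hc0 : ∀ t, IsUnit (avgTow (QBlev L (cubic d (evenPeriod t))) ((L : ℝ) ^ d) (fun k' => (calDalev L (cubic d (evenPeriod t)) a ha k' + covPert L (cubic d (evenPeriod t)) (fun k'' ν' (x'
          : idx L (cubic d (evenPeriod t)) k'') => Complex.exp (Complex.I * ((A₀ t) k'' ν' x' : ℂ) / ((lev L k'' : ℕ) : ℂ))) k')⁻¹) k).det) {P Pc : B12Beta.Kernel d}
    (h : IsInfiniteVolumeLimit evenPeriod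
      (fun t μ' ν' (z : Site d (evenPeriod t)) =>
          ((deriv (fun r : ℝ => deriv (fun s : ℝ => (avgTow (QBlev L (cubic d (evenPeriod t))) ((L : ℝ) ^ d)
          (fun k' => (calDalev L (cubic d (evenPeriod t)) a ha k' + covPert L (cubic d (evenPeriod t)) (fun k'' ν' (x' : idx L (cubic d (evenPeriod t)) k'') => Complex.exp
                (Complex.I * ((A₀ t) k'' ν' x' : ℂ) / ((lev L k'' : ℕ) : ℂ) + (Complex.I * ((A t) k'' ν' x' : ℂ) / ((lev L k'' : ℕ) : ℂ)) * ((s : ℝ) : ℂ) + (Complex.I * ((B t) k'' ν' x' :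
                      ℂ) / ((lev L k'' : ℕ) : ℂ)) * ((r : ℝ) :
                ℂ))) k')⁻¹) k)⁻¹) 0) 0)
            ((unitIdx L (cubic d (evenPeriod t))).symm (z, μ')) ((unitIdx L (cubic d (evenPeriod t))).symm (0, ν'))).re) P)
    (hc : IsInfiniteVolumeLimit evenPeriod
      (fun t μ' ν' (z : Site d (evenPeriod t)) =>
          ((deriv (fun r : ℝ => deriv (fun s : ℝ => (avgTow (QBlev L (cubic d (evenPeriod t))) ((L : ℝ) ^ d)
          (fun k' => (calDalev L (cubic d (evenPeriod t)) a ha k' + covPert L (cubic d (evenPeriod t)) (fun k'' ν' (x' : idx L (cubic d (evenPeriod t)) k'') => Complex.exp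
                (Complex.I * ((A₀ t) k'' ν' x' : ℂ) / ((lev L k'' : ℕ) : ℂ) + (Complex.I * ((A t) k'' ν' x' : ℂ) / ((lev L k'' : ℕ) : ℂ)) * ((s : ℝ) : ℂ) + (Complex.I * ((c * B t k'' ν' x'
                      : ℝ) : ℂ) / ((lev L k'' : ℕ) : ℂ)) * ((r : ℝ) :
                ℂ))) k')⁻¹) k)⁻¹) 0) 0)
            ((unitIdx L (cubic d (evenPeriod t))).symm (z, μ')) ((unitIdx L (cubic d (evenPeriod t))).symm (0, ν'))).re) Pc) :
    ∀ μ ν (x : Fin d → ℤ), Pc μ ν x = c * P μ ν x := by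
  intro μ ν x
  refine tendsto_nhds_unique (hc μ ν x) (((h μ ν x).const_mul c).congr fun t => ?_)
  dsimp only
  rw [hessianAt_smul_right L (cubic d (evenPeriod t)) a ha c (A₀ t) (A t) (B t) k (h0 t) (hc0 t), Matrix.smul_apply, smul_eq_mul, Complex.re_ofReal_mul]

end Kernels

end Summit.QuantumFields.BalabanUV.Beta.GAN24.ExponentialChartBaseHessianKernels

end
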